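import Mathlib.MeasureTheory.Integral.IntervalIntegral.FundThmCalculus
import Mathlib.Analysis.Normed.Operator.BanachSteinhaus
import Mathlib.Analysis.Calculus.Deriv.Shift
import Literature.Analysis.UnboundedOperators.UnitaryRep
import HarnessLib

/-!
# Orbit integrals of strongly continuous groups and the form of the Stone generator
(trunk G07 UnbddOp, proofs layer over items C3 `StrongContRepresentation` and C4 `UnitaryRep`)

For a strongly continuous one-parameter group `U : OneParameterGroup 𝕜 E` on a Banach space we
prove the standard "mollifier" lemmas of semigroup theory (Engel–Nagel, Ch. II Lemma 1.3 and the
proof of Thm. 1.4, specialised to groups):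

* `OneParameterGroup.integralCLM U a b : E →L[𝕜] E`, `x ↦ ∫ s in a..b, U(s) x ds` (bounded by
  Banach–Steinhaus, Engel–Nagel Prop. I.5.5);
* `OneParameterGroup.hasDerivAt_app_integral`: `h ↦ U(h) ∫ₐᵇ U(s) x ds` has derivative
  `U(b) x - U(a) x` at `0`; hence `∫₀ᵗ U(s) x ds ∈ D(A)` with `A ∫₀ᵗ U(s) x ds = U(t) x - x`
  (Engel–Nagel Lemma II.1.3 (iii));
* `OneParameterGroup.tendsto_inv_smul_integral_app`: `t⁻¹ ∫₀ᵗ U(s) x ds → x` (`t → 0`), hence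
  `OneParameterGroup.dense_generator_domain` (Engel–Nagel Thm. II.1.4, group case);
* `OneParameterGroup.mem_generator_domain_of_hasDerivAt`: a (two-sided) derivative of the orbit at
  `0` is the value of the generator.

For a strongly continuous one-parameter *unitary* group `U` on a Hilbert space (item C4) we deduce:

* `UnitaryRep.inner_generator_eq_neg`: the generator `A` is skew-symmetric,
  `⟪A x, y⟫ = -⟪x, A y⟫` on `D(A)`, hence `UnitaryRep.hamiltonian_isSymmetric`: the Hamiltonian
  `H = -i A` is symmetric (the elementary half of Stone's theorem, Reed–Simon I Thm. VIII.7 (c) /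
  proof of Thm. VIII.8);
* `UnitaryRep.hasPositiveEnergy_of_dense`: a *mollifier criterion for positivity of the energy*:
  if `0 ≤ Im ⟪∫₀ᵗ U(s) x ds, U(t) x - x⟫` for all `t > 0` and all `x` in a dense subset, then
  `H ≥ 0` in the form sense (`U.HasPositiveEnergy`). (For `x ∈ D(A)` one has
  `⟪x, H x⟫ = lim_{t ↓ 0} t⁻² · Im ⟪∫₀ᵗ U(s) x ds, U(t) x - x⟫`, and the bracket is continuous in
  `x` for fixed `t`.) This replaces the core theorem (Bratteli–Robinson I Cor. 3.1.7,
  Reed–Simon I Thm. VIII.11) in the proof that ground states have positive GNS Hamiltonian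
  (Sakai 1991 Prop. 4.2.3; Bratteli–Robinson II Prop. 5.3.19).

Sources: K.-J. Engel, R. Nagel, *One-Parameter Semigroups for Linear Evolution Equations*
(Springer GTM 194, 2000), Prop. I.5.5, Lemma II.1.3, Thm. II.1.4; M. Reed, B. Simon, *Methods of
Modern Mathematical Physics I* (1980), §VIII.4, Thms. VIII.7–VIII.8; S. Sakai, *Operator Algebras
in Dynamical Systems* (CUP 1991), Prop. 4.2.3.

## Design notes

* The Banach-space lemmas assume both `[NormedSpace 𝕜 E]` and `[NormedSpace ℝ E]` (the interval
  integral and `HasDerivAt` over `ℝ` use the real structure) and `[IsScalarTower ℝ 𝕜 E]` where the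
  `𝕜`-valued difference quotient of item C3 is compared with real derivatives; for `𝕜 = ℂ` all of
  these are instances (`NormedSpace.complexToReal`, `IsScalarTower.complexToReal`).
* No new definitions besides the bundled orbit integral `integralCLM` (with `rfl`-lemma
  `integralCLM_apply`); everything else is a theorem about the existing C3/C4 notions.
-/

noncomputable section

open Filter Topology MeasureTheory intervalIntegral ComplexConjugate
open scoped InnerProductSpace NNReal

namespace Literature.Analysis.UnboundedOperators

namespace OneParameterGroup

section Banach

variable {𝕜 E : Type*} [RCLike 𝕜] [NormedAddCommGroup E] [NormedSpace 𝕜 E]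

/-- Orbit maps of a strongly continuous group are interval integrable (they are continuous;
Engel–Nagel (2000), Ch. I Def. 5.1). [cite: EngelNagel2000, Ch. I Def. 5.1] -/
theorem intervalIntegrable_app (U : OneParameterGroup 𝕜 E) (x : E) (a b : ℝ) :
    IntervalIntegrable (fun s => U.app s x) volume a b :=
  (U.continuous_app x).intervalIntegrable a b

/-- `U(h) (U(s) x) = U(s + h) x` (the group law, Engel–Nagel (2000), Ch. I Def. 5.1 (FE)).
[cite: EngelNagel2000, Ch. I Def. 5.1] -/
theorem app_app (U : OneParameterGroup 𝕜 E) (h s : ℝ) (x : E) :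
    U.app h (U.app s x) = U.app (s + h) x := by
  rw [add_comm, app_add]
  rfl

/-- The operators of a strongly continuous group on a Banach space are uniformly bounded on compact
time intervals (uniform boundedness principle; Engel–Nagel (2000), Ch. I Prop. 5.5).
[cite: EngelNagel2000, Ch. I Prop. 5.5] -/
theorem exists_norm_app_le [CompleteSpace E] (U : OneParameterGroup 𝕜 E) (a b : ℝ) :
    ∃ C : ℝ, ∀ s ∈ Set.Icc a b, ‖U.app s‖ ≤ C := by
  obtain ⟨C, hC⟩ := banach_steinhaus (g := fun s : Set.Icc a b => U.app (s : ℝ)) fun x => by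
    obtain ⟨C, hC⟩ := (isCompact_Icc (a := a) (b := b)).exists_bound_of_continuousOn
      ((U.continuous_app x).continuousOn)
    exact ⟨C, fun s => hC s s.2⟩
  exact ⟨C, fun s hs => hC ⟨s, hs⟩⟩

variable [NormedSpace ℝ E]

section Complete

variable [CompleteSpace E]

/-- The **orbit integral** `x ↦ ∫ s in a..b, U(s) x ds` of a strongly continuous group on a Banach
space, as a continuous linear map (linearity of the Bochner integral; boundedness from
`exists_norm_app_le`). Engel–Nagel (2000), Ch. II Lemma 1.3 (iii). [cite: EngelNagel2000, Ch. II Lemma 1.3] -/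
def integralCLM (U : OneParameterGroup 𝕜 E) (a b : ℝ) : E →L[𝕜] E :=
  LinearMap.mkContinuousOfExistsBound
    { toFun := fun x => ∫ s in a..b, U.app s x
      map_add' := fun x y => by
        simp only [map_add]
        exact integral_add (U.intervalIntegrable_app x a b) (U.intervalIntegrable_app y a b)
      map_smul' := fun c x => by
        simp only [map_smul, RingHom.id_apply]
        exact intervalIntegral.integral_smul c _ }
    (by
      obtain ⟨C, hC⟩ := U.exists_norm_app_le (min a b) (max a b)
      refine ⟨|C| * |b - a|, fun x => ?_⟩
      calc ‖∫ s in a..b, U.app s x‖ ≤ (|C| * ‖x‖) * |b - a| := by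
            refine norm_integral_le_of_norm_le_const fun s hs => ?_
            have hs' : s ∈ Set.Icc (min a b) (max a b) := ⟨hs.1.le, hs.2⟩
            calc ‖U.app s x‖ ≤ ‖U.app s‖ * ‖x‖ := (U.app s).le_opNorm x
              _ ≤ |C| * ‖x‖ := by gcongr; exact (hC s hs').trans (le_abs_self C)
        _ = |C| * |b - a| * ‖x‖ := by ring)

/-- Unfolding lemma for the orbit integral (Engel–Nagel (2000), Ch. II Lemma 1.3).
[cite: EngelNagel2000, Ch. II Lemma 1.3] -/
@[simp]
theorem integralCLM_apply (U : OneParameterGroup 𝕜 E) (a b : ℝ) (x : E) :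
    U.integralCLM a b x = ∫ s in a..b, U.app s x :=
  rfl

/-- The orbit integral depends continuously on the vector (Engel–Nagel (2000), Ch. II Lemma 1.3).
[cite: EngelNagel2000, Ch. II Lemma 1.3] -/
@[continuity, fun_prop]
theorem continuous_integral_app (U : OneParameterGroup 𝕜 E) (a b : ℝ) :
    Continuous fun x : E => ∫ s in a..b, U.app s x :=
  (U.integralCLM a b).continuous

/-- `U(h) ∫ₐᵇ U(s) x ds = ∫_{a+h}^{b+h} U(s) x ds` (Engel–Nagel (2000), proof of Ch. II Lemma 1.3
(iii)). [cite: EngelNagel2000, Ch. II Lemma 1.3] -/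
theorem app_integral_app (U : OneParameterGroup 𝕜 E) (x : E) (a b h : ℝ) :
    U.app h (∫ s in a..b, U.app s x) = ∫ s in (a + h)..(b + h), U.app s x := by
  rw [← (U.app h).intervalIntegral_comp_comm (U.intervalIntegrable_app x a b)]
  simp_rw [app_app]
  exact intervalIntegral.integral_comp_add_right (fun s => U.app s x) h

/-- **Engel–Nagel Lemma II.1.3 (iii), group version, derivative form**: for every `x` and `a, b`,
`h ↦ U(h) ∫ₐᵇ U(s) x ds` is differentiable at `h = 0` with derivative `U(b) x - U(a) x`.
[cite: EngelNagel2000, Ch. II Lemma 1.3 (iii)] -/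
theorem hasDerivAt_app_integral (U : OneParameterGroup 𝕜 E) (x : E) (a b : ℝ) :
    HasDerivAt (fun h : ℝ => U.app h (∫ s in a..b, U.app s x)) (U.app b x - U.app a x) 0 := by
  have hg : Continuous fun s => U.app s x := U.continuous_app x
  have key : (fun h : ℝ => U.app h (∫ s in a..b, U.app s x)) =
      fun h => (∫ s in a..(b + h), U.app s x) - ∫ s in a..(a + h), U.app s x := by
    funext h
    rw [app_integral_app, intervalIntegral.integral_interval_sub_left (hg.intervalIntegrable _ _)
      (hg.intervalIntegrable _ _)]
  rw [key]
  have h1 : HasDerivAt (fun h : ℝ => ∫ s in a..(b + h), U.app s x) (U.app b x) 0 := by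
    have := (hg.integral_hasStrictDerivAt a (b + 0)).hasDerivAt.comp_const_add b 0
    simpa only [add_zero] using this
  have h2 : HasDerivAt (fun h : ℝ => ∫ s in a..(a + h), U.app s x) (U.app a x) 0 := by
    have := (hg.integral_hasStrictDerivAt a (a + 0)).hasDerivAt.comp_const_add a 0
    simpa only [add_zero] using this
  exact h1.sub h2

/-- `t⁻¹ ∫₀ᵗ U(s) x ds → x` as `t → 0`, `t ≠ 0` (Engel–Nagel (2000), proof of Ch. II Thm. 1.4,
density of the generator domain). [cite: EngelNagel2000, Ch. II Thm. 1.4] -/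
theorem tendsto_inv_smul_integral_app (U : OneParameterGroup 𝕜 E) (x : E) :
    Tendsto (fun t : ℝ => t⁻¹ • ∫ s in (0 : ℝ)..t, U.app s x) (𝓝[≠] 0) (𝓝 x) := by
  have h := ((U.continuous_app x).integral_hasStrictDerivAt 0 0).hasDerivAt
  rw [hasDerivAt_iff_tendsto_slope] at h
  simp only [app_zero, one_apply_eq_self] at h
  refine h.congr' (Eventually.of_forall fun t => ?_)
  simp only [slope_def_module, sub_zero, intervalIntegral.integral_same]

end Complete

variable [IsScalarTower ℝ 𝕜 E]

/-- If the orbit `t ↦ U(t) x` has (two-sided) derivative `y` at `t = 0`, then `x ∈ D(A)` and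
`A x = y` for the generator `A` of item C3 (Engel–Nagel (2000), Ch. II Def. 1.2 and §II.3.11).
[cite: EngelNagel2000, Ch. II Def. 1.2] -/
theorem mem_generator_domain_of_hasDerivAt (U : OneParameterGroup 𝕜 E) {x y : E}
    (h : HasDerivAt (fun t : ℝ => U.app t x) y 0) :
    ∃ hx : x ∈ U.generator.domain, U.generator ⟨x, hx⟩ = y := by
  have ht : Tendsto (fun t : ℝ => ((t⁻¹ : ℝ) : 𝕜) • (U.toC0Semigroup.app t.toNNReal x - x))
      (𝓝[>] 0) (𝓝 y) := by
    rw [hasDerivAt_iff_tendsto_slope] at h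
    have h' := h.mono_left (nhdsWithin_mono _
      (show Set.Ioi (0 : ℝ) ⊆ {0}ᶜ from fun t ht => ne_of_gt ht))
    refine h'.congr' ?_
    filter_upwards [self_mem_nhdsWithin] with t (ht : 0 < t)
    rw [slope_def_module, toC0Semigroup_app, Real.coe_toNNReal _ ht.le, sub_zero, app_zero,
      one_apply_eq_self, RCLike.real_smul_eq_coe_smul (K := 𝕜)]
  have hx : x ∈ U.generator.domain :=
    (C0Semigroup.mem_generator_domain_iff U.toC0Semigroup x).mpr ⟨y, ht⟩
  exact ⟨hx, C0Semigroup.generator_apply_eq_of_tendsto U.toC0Semigroup ⟨x, hx⟩ ht⟩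

variable [CompleteSpace E]

/-- **Engel–Nagel Lemma II.1.3 (iii), group version**: `∫₀ᵗ U(s) x ds ∈ D(A)` and
`A ∫₀ᵗ U(s) x ds = U(t) x - x`. [cite: EngelNagel2000, Ch. II Lemma 1.3 (iii)] -/
theorem integral_mem_generator_domain (U : OneParameterGroup 𝕜 E) (x : E) (t : ℝ) :
    ∃ hx : (∫ s in (0 : ℝ)..t, U.app s x) ∈ U.generator.domain,
      U.generator ⟨_, hx⟩ = U.app t x - x := by
  have := U.hasDerivAt_app_integral x 0 t
  simp only [app_zero, one_apply_eq_self] at this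
  exact U.mem_generator_domain_of_hasDerivAt this

/-- **Engel–Nagel Thm. II.1.4 (group case)**: the generator of a strongly continuous group on a
Banach space is densely defined (`t⁻¹ ∫₀ᵗ U(s) x ds ∈ D(A)` tends to `x`).
[cite: EngelNagel2000, Ch. II Thm. 1.4] -/
theorem dense_generator_domain (U : OneParameterGroup 𝕜 E) :
    Dense (U.generator.domain : Set E) := by
  intro x
  refine mem_closure_of_tendsto (U.tendsto_inv_smul_integral_app x) (Eventually.of_forall fun t => ?_)
  rw [RCLike.real_smul_eq_coe_smul (K := 𝕜)]
  exact Submodule.smul_mem _ _ (U.integral_mem_generator_domain x t).1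

end Banach

end OneParameterGroup

/-! ### Unitary groups: skew-symmetry of the generator and the mollifier positivity criterion -/

namespace UnitaryRep

variable {H : Type*} [NormedAddCommGroup H] [InnerProductSpace ℂ H] [CompleteSpace H]

/-- `U(t) (U(-t) x) = x` for a one-parameter unitary group (Reed–Simon I, §VIII.4). [folklore] -/
@[simp]
theorem appReal_apply_appReal_neg (U : OneParameterUnitaryGroup H) (t : ℝ) (x : H) :
    U.appReal t (U.appReal (-t) x) = x := by
  rw [← mul_apply_eq_comp, ← appReal_add, add_neg_cancel, appReal_zero,
    one_apply_eq_self]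

/-- `U(-t) (U(t) x) = x` for a one-parameter unitary group (Reed–Simon I, §VIII.4). [folklore] -/
@[simp]
theorem appReal_neg_apply_appReal (U : OneParameterUnitaryGroup H) (t : ℝ) (x : H) :
    U.appReal (-t) (U.appReal t x) = x := by
  rw [← mul_apply_eq_comp, ← appReal_add, neg_add_cancel, appReal_zero,
    one_apply_eq_self]

/-- `‖U(t) x‖ = ‖x‖` (Reed–Simon I, §VIII.4). [folklore] -/
@[simp]
theorem norm_appReal (U : OneParameterUnitaryGroup H) (t : ℝ) (x : H) : ‖U.appReal t x‖ = ‖x‖ :=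
  U.norm_map _ x

/-- `⟪U(t) x, y⟫ = ⟪x, U(-t) y⟫`: the adjoint of `U(t)` is `U(-t)` (Reed–Simon I, §VIII.4).
[folklore] -/
theorem inner_appReal_left (U : OneParameterUnitaryGroup H) (t : ℝ) (x y : H) :
    ⟪U.appReal t x, y⟫_ℂ = ⟪x, U.appReal (-t) y⟫_ℂ := by
  conv_lhs => rw [← U.appReal_apply_appReal_neg t y]
  exact U.inner_map_map _ x _

/-- If `z(t) → z₀` as `t ↓ 0` then `U(-t) z(t) → z₀` (isometry plus strong continuity;
Reed–Simon I, §VIII.4, proof of Thm. VIII.7). [folklore] -/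
theorem tendsto_appReal_neg_apply (U : OneParameterUnitaryGroup H) {l : Filter ℝ}
    (hl : l ≤ 𝓝 0) {z : ℝ → H} {z₀ : H} (hz : Tendsto z l (𝓝 z₀)) :
    Tendsto (fun t => U.appReal (-t) (z t)) l (𝓝 z₀) := by
  rw [tendsto_iff_norm_sub_tendsto_zero] at hz ⊢
  have h2 : Tendsto (fun t : ℝ => ‖U.appReal (-t) z₀ - z₀‖) l (𝓝 0) := by
    have hc : Continuous fun t : ℝ => ‖U.appReal (-t) z₀ - z₀‖ := by fun_prop
    have := hc.tendsto 0
    simp only [neg_zero, appReal_zero, one_apply_eq_self, sub_self, norm_zero] at this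
    exact this.mono_left hl
  refine squeeze_zero (fun t => norm_nonneg _) (fun t => ?_) (by simpa using hz.add h2)
  calc ‖U.appReal (-t) (z t) - z₀‖
      = ‖U.appReal (-t) (z t - z₀) + (U.appReal (-t) z₀ - z₀)‖ := by
        congr 1; simp only [map_sub]; abel
    _ ≤ ‖U.appReal (-t) (z t - z₀)‖ + ‖U.appReal (-t) z₀ - z₀‖ := norm_add_le _ _
    _ = ‖z t - z₀‖ + ‖U.appReal (-t) z₀ - z₀‖ := by rw [norm_appReal]

/-- **The generator of a unitary group is skew-symmetric**: `⟪A x, y⟫ = -⟪x, A y⟫` for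
`x, y ∈ D(A)`, where `U(t) = exp (t A)` (Reed–Simon I, Thm. VIII.7 (c) and proof of Thm. VIII.8:
`⟪t⁻¹(U(t) x - x), y⟫ = ⟪x, t⁻¹(U(-t) y - y)⟫`). [cite: ReedSimonI1980, Thm. VIII.7] -/
theorem inner_generator_eq_neg (U : OneParameterUnitaryGroup H)
    (x y : (OneParameterGroup.generator U.toStrongContRepresentation).domain) :
    ⟪(OneParameterGroup.generator U.toStrongContRepresentation x : H), (y : H)⟫_ℂ =
      -⟪(x : H), OneParameterGroup.generator U.toStrongContRepresentation y⟫_ℂ := by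
  set T := OneParameterGroup.toC0Semigroup U.toStrongContRepresentation with hT
  have hx := C0Semigroup.tendsto_generator T x
  have hy := C0Semigroup.tendsto_generator T y
  have hTt : ∀ t : ℝ, 0 < t → T.app t.toNNReal = U.appReal t := fun t ht => by
    rw [hT, OneParameterGroup.toC0Semigroup_app, Real.coe_toNNReal _ ht.le,
      app_toStrongContRepresentation]
  -- the difference quotients of `x`, paired with `y`
  have h1 : Tendsto (fun t : ℝ => ⟪((t⁻¹ : ℝ) : ℂ) • (T.app t.toNNReal (x : H) - x), (y : H)⟫_ℂ)
      (𝓝[>] 0) (𝓝 ⟪(OneParameterGroup.generator U.toStrongContRepresentation x : H), (y : H)⟫_ℂ) :=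
    hx.inner tendsto_const_nhds
  -- ... equal `⟪x, -(U(-t) (difference quotient of y))⟫`
  have h2 : ∀ᶠ t : ℝ in 𝓝[>] 0, ⟪((t⁻¹ : ℝ) : ℂ) • (T.app t.toNNReal (x : H) - x), (y : H)⟫_ℂ =
      ⟪(x : H), -(U.appReal (-t) (((t⁻¹ : ℝ) : ℂ) • (T.app t.toNNReal (y : H) - y)))⟫_ℂ := by
    filter_upwards [self_mem_nhdsWithin] with t (ht : 0 < t)
    rw [hTt t ht, inner_smul_left, Complex.conj_ofReal, map_smul, map_sub, inner_neg_right,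
      inner_smul_right, inner_sub_left, inner_sub_right, appReal_neg_apply_appReal,
      inner_appReal_left]
    ring
  -- ... which tend to `⟪x, -A y⟫`
  have h3 : Tendsto (fun t : ℝ =>
      ⟪(x : H), -(U.appReal (-t) (((t⁻¹ : ℝ) : ℂ) • (T.app t.toNNReal (y : H) - y)))⟫_ℂ)
      (𝓝[>] 0) (𝓝 ⟪(x : H), -(OneParameterGroup.generator U.toStrongContRepresentation y : H)⟫_ℂ) :=
    tendsto_const_nhds.inner (U.tendsto_appReal_neg_apply nhdsWithin_le_nhds hy).neg
  rw [← inner_neg_right]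
  exact tendsto_nhds_unique (h1.congr' h2) h3

/-- **The Hamiltonian of a one-parameter unitary group is symmetric**: `⟪H x, y⟫ = ⟪x, H y⟫` on
`D(H)`, `H = -i A` (the elementary half of Stone's theorem; Reed–Simon I, Thm. VIII.8, first step
of the proof). [cite: ReedSimonI1980, Thm. VIII.8] -/
theorem hamiltonian_isSymmetric (U : OneParameterUnitaryGroup H) : U.hamiltonian.IsSymmetric := by
  intro x y
  rw [hamiltonian_apply, hamiltonian_apply, inner_smul_left, inner_smul_right,
    inner_generator_eq_neg]
  simp only [map_neg, Complex.conj_I, neg_neg, mul_neg, neg_mul]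

/-- **Mollifier criterion for positive energy.** Let `U(t) = exp (itH)` be a strongly continuous
one-parameter unitary group and `D ⊆ 𝓗` dense. If `0 ≤ Im ⟪∫₀ᵗ U(s) x ds, U(t) x - x⟫` for all
`x ∈ D` and `t > 0`, then `H ≥ 0` in the form sense (`U.HasPositiveEnergy`). Indeed the bracket is
continuous in `x`, so the inequality holds for all `x`; for `x ∈ D(H)`,
`t⁻¹ ∫₀ᵗ U(s) x ds → x` and `t⁻¹ (U(t) x - x) → A x = i H x`, so `t⁻² Im ⟪…⟫ → Im ⟪x, A x⟫ = ⟪x, H x⟫`.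
(A substitute for the core theorem, Reed–Simon I Thm. VIII.11 / Bratteli–Robinson I Cor. 3.1.7, in
Sakai's proof that ground states have `H_ω ≥ 0`, Sakai (1991) Prop. 4.2.3.) [folklore] -/
theorem hasPositiveEnergy_of_dense (U : OneParameterUnitaryGroup H) {D : Set H} (hD : Dense D)
    (h : ∀ x ∈ D, ∀ t : ℝ, 0 < t →
      0 ≤ (⟪∫ s in (0 : ℝ)..t, U.appReal s x, U.appReal t x - x⟫_ℂ).im) :
    U.HasPositiveEnergy := by
  refine ⟨U.hamiltonian_isSymmetric, fun x => ?_⟩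
  have hTt : ∀ t : ℝ, 0 < t →
      (OneParameterGroup.toC0Semigroup U.toStrongContRepresentation).app t.toNNReal = U.appReal t :=
    fun t ht => by
      rw [OneParameterGroup.toC0Semigroup_app, Real.coe_toNNReal _ ht.le, app_toStrongContRepresentation]
  -- Step 1: the inequality holds for every vector, by density and continuity.
  have hall : ∀ t : ℝ, 0 < t → ∀ z : H,
      0 ≤ (⟪∫ s in (0 : ℝ)..t, U.appReal s z, U.appReal t z - z⟫_ℂ).im := by
    intro t ht z
    have hc : Continuous fun z : H => (⟪∫ s in (0 : ℝ)..t, U.appReal s z, U.appReal t z - z⟫_ℂ).im := by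
      have h1 : Continuous fun z : H => ∫ s in (0 : ℝ)..t, U.appReal s z := by
        simpa only [app_toStrongContRepresentation] using
          OneParameterGroup.continuous_integral_app U.toStrongContRepresentation 0 t
      exact Complex.continuous_im.comp (h1.inner (by fun_prop))
    have hcl : IsClosed {z : H | 0 ≤ (⟪∫ s in (0 : ℝ)..t, U.appReal s z, U.appReal t z - z⟫_ℂ).im} :=
      isClosed_le continuous_const hc
    exact (hcl.closure_subset_iff.mpr fun w hw => h w hw t ht) (hD z)
  -- Step 2: pass to the limit `t ↓ 0` for `x ∈ D(H) = D(A)`.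
  have hx : Tendsto (fun t : ℝ => t⁻¹ • (U.appReal t (x : H) - x)) (𝓝[>] 0)
      (𝓝 (OneParameterGroup.generator U.toStrongContRepresentation x : H)) := by
    refine (C0Semigroup.tendsto_generator
      (OneParameterGroup.toC0Semigroup U.toStrongContRepresentation) x).congr' ?_
    filter_upwards [self_mem_nhdsWithin] with t (ht : 0 < t)
    rw [hTt t ht, ← RCLike.real_smul_eq_coe_smul (K := ℂ)]
  have hm : Tendsto (fun t : ℝ => t⁻¹ • ∫ s in (0 : ℝ)..t, U.appReal s (x : H)) (𝓝[>] 0)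
      (𝓝 (x : H)) := by
    have := (OneParameterGroup.tendsto_inv_smul_integral_app U.toStrongContRepresentation
      (x : H)).mono_left (nhdsWithin_mono _ (show Set.Ioi (0 : ℝ) ⊆ {0}ᶜ from fun t ht => ne_of_gt ht))
    simpa only [app_toStrongContRepresentation] using this
  have hlim := (Complex.continuous_im.tendsto _).comp (hm.inner hx)
  have hre : RCLike.re ⟪(x : H), U.hamiltonian x⟫_ℂ =
      (⟪(x : H), (OneParameterGroup.generator U.toStrongContRepresentation x : H)⟫_ℂ).im := by
    rw [hamiltonian_apply, inner_smul_right]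
    simp only [RCLike.re_to_complex, neg_mul, Complex.neg_re, Complex.mul_re, Complex.I_re,
      zero_mul, Complex.I_im, one_mul, zero_sub, neg_neg]
  rw [hre]
  refine ge_of_tendsto hlim ?_
  filter_upwards [self_mem_nhdsWithin] with t (ht : 0 < t)
  simp only [Function.comp_apply]
  rw [inner_smul_left_eq_smul, inner_smul_right_eq_smul, Complex.smul_im, Complex.smul_im,
    smul_eq_mul, smul_eq_mul]
  exact mul_nonneg (inv_nonneg.mpr ht.le) (mul_nonneg (inv_nonneg.mpr ht.le) (hall t ht x))

end UnitaryRep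

end Literature.Analysis.UnboundedOperators
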